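import Summits.QuantumFields.BalabanUV.Beta.EriceRemainderEnclosureHistoryAutonomyComparisonAgeCompositionDecayBudgetSlots

/-!
# EriceRemainderEnclosureHistoryAutonomyComparisonAgeCompositionDecayBudgetWindow — (E84d, first part) route (N), first order: WINDOW FACTS FOR THE SLOT
# CERTIFICATES of the (S-d) budget — the rise across any stretch of scales dominates the two ages' reads summed over it (the «crux relation» that makes
# the window mass small against the rise `ρ_p − 1` the credit step is amplified by), the levels after a pin lie below the tangent at that pin (concavity:
# `a_{n+j} ≤ a_n + j·(a_{n+1} − a_n)`, so every read inside the next window is within a factor of the read at its top), the boundary's old part is free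
# (`3c_{m+k+1}ρ′ ≥ c_{m+2}`), and the telescoping minorant of `Σ_j (c+j)^{−3∕2}` that funds the boundary's young part uniformly in the age

Cell `pub-balaban`, β-function sub-cell, BINDER row D4 «RemainderConst leaves for Bałaban's split» (`HOME/BINDER-OWNERS.md`; owner lineage `b2b-balaban-beta-an4`;
this file by co-owner #2 lineage `b2b-balaban-beta-d4-p2`, generation 75), β-FLOW TEAM duty (1), FREEZE (0) honoured (def-free; imports (E84c)
`…DecayBudgetSlots`; uses (E48a) `strictAnti_of_memFlow`, (E58b) `increment_anti` ∕ `mul_invSq_add_le` BY NAME; nothing restated).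

HONEST FRAMING (page 1, verbatim and binding).  *"Discharging BetaPertH makes Bałaban's UV stability UNCONDITIONAL — a real constructive-QFT result; it is
NOT the continuum limit and NOT the Clay problem."*  THIS FILE DISCHARGES NOTHING OF THE KIND.  Elementary real analysis about ABSTRACT functionals on a box
]0,γ]^ℕ with displayed floors, profiles and signs, and the FIRST-ORDER renewal objects of route (N) built from them — hypotheses of a census, not facts; the
form, signs, ages and moments of Bałaban's (1.22) limit functional are NOT PRINTED ([I] p. 298; GAPS G-t4-U2-1∕-2) and NOT asserted.  Row D4 class
UNCHANGED (critical-path width 0; instance 0∕1; D4 DISCHARGE NO DATE).  HONEST DEPENDENCY: continuum YM on T⁴ ⇐ BetaPertH ∧ nine spine estimates (0/9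
proved); BetaPertH ⇐ (D1) ∧ (D4) ∧ CAP+tail; G-an2-4 gates asym, D1 and NE2/3/4.

THE POINT (census sense (α); route (N); README `HOME/b2b-balaban-beta-d4-p2/g75/e84/README.md` §3).  The slot inequality of (E84c) `budget_of_slots` compares
the credit `(3∕2)(y_p + y_p²∕2)` (with `y_p ≥ 2d_{p+1}ρ¹_p + 2c_{p+1}ρ_p`, (E84c) `step_ge_reads`) against debits carrying the factor `ω_p∕ρ_p` (`ω_p = x_p∕(1−x_p)` the
window-mass amplification of the chain, `ρ_p = a_{p+k+1}∕a_{p+1}` the rise the credit step is amplified by) and the boundary's young part `d_{m+2}(1 + H′)` against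
the young surpluses of all slots.  What controls `ω_p∕ρ_p` is §1 **`invSq_sub_ge_window_reads`**: THE RISE ACROSS ANY STRETCH DOMINATES THE READS SUMMED OVER IT,
`1∕h_{n+j}² − 1∕h_n² ≥ Σ_{q<j} (L_1h_{n+q+2} + L_kh_{n+q+k+1})` — applied on `[p+1, p+k+1)` it is `ρ_p − 1 ≥ h_{p+1}²·Σ_{q∈window}(L_1h_{q+2} + L_kh_{q+k+1})`
(numerics of record, `g75/numerics/p6.py` Q5r: `(ρ_p − 1)∕ω_p ≥ 1.55` along every flow; a saturated young age makes `ρ_p` large too), together with §2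
**`invSq_add_le_tangent`**: THE LEVELS AFTER A PIN LIE BELOW THE TANGENT, `1∕h_{n+j}² ≤ 1∕h_n² + j·(1∕h_{n+1}² − 1∕h_n²)` ((E58b) `increment_anti`), whence
**`read_ge_of_tangent`**: `h_{n+j}² ·(1 + j·((h_n∕h_{n+1})² − 1)) ≥ h_n²` — every read inside the window below a pin is within the factor `(1 + jE)^{−1∕2}` of the
read at its top (`E` the level step there, `≤ σ′∕k` by (E82b) `step_le_of_window`), so the sum in §1 is at least `k` comparable terms; and at `j = 2` the young
debit ratio `d_{p−1}∕d_{p+1} = (a_{p+2}∕a_p)^{3∕2} ≤ (1 + 2z_p)^{3∕2}`.  §3 **`boundary_old`**: the boundary's old part costs nothing,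
`L_kh_{m+k+2}³∕2 ≤ 3·(L_k∕2)h_{m+k+1}²h_{m+2k+1}` (`c_{m+2} ≤ 3c_{m+k+1}ρ′`: `h_{m+k+2} ≤ h_{m+k+1}` and `h_{m+k+1} ≤ 3h_{m+2k+1}` by (E58b) `mul_invSq_add_le`).
§4 **`sum_rpow_ge_telescope`**: `Σ_{j<k} (c+j)^{−3∕2} ≥ 2((c)^{−1∕2} − (c+k)^{−1∕2})` for `c > 0` — with (E58b) `mul_sqrt_le_read` (`d_{p+1} ≥ d_{m+2}((m+3)∕(p+2))^{3∕2}`)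
the k-uniform minorant of the boundary's funding `Σ_p S_p`.  NOT CLAIMED: the slot and boundary certificates (successor); anything printed.

WHAT IS PROVED ([folklore]; 0 `def`, 0 sorry).  §1 **`invSq_sub_ge_window_reads`**, `rise_ge_window_reads`; §2 **`invSq_add_le_tangent`**, **`read_ge_of_tangent`**;
§3 **`boundary_old`**; §4 `rpow_neg_three_halves_ge`, **`sum_rpow_ge_telescope`**.  v1.1 (same unit and generation) APPENDS §5 **`young_debit_le`**: the young
window-damping debit of a slot against its young credit WITHOUT any window-mass factor — `h_p³ ≤ (1 + 1∕p)²·h_{p+1}²h_{p+2}` (`p ≥ 1`; `(h_p∕h_{p+1})² ≤ 1 + 1∕p`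
by (E84c) `step_le_inv`, `(h_p∕h_{p+2})² ≤ 2(h_p∕h_{p+1})² − 1 ≤ 1 + 2∕p` by §2, `√(1+2∕p) ≤ 1 + 1∕p`), i.e. `d_{p−1} ≤ (1+1∕p)²·d_{p+1}ρ¹_p ≤ (9∕4)·d_{p+1}ρ¹_p` for
`p ≥ 2` against the credit `3d_{p+1}ρ¹_p`: the ω-free young surplus `≥ (3 − (1+1∕p)²)·d_{p+1}ρ¹_p` that funds the boundary (numerics `g75/numerics/p12.py` ylin:
exact minima `3 − (1+1∕p)√(1+2∕p)` = 0.88, 1.28, 1.47 in units `d_{p+1}ρ¹_p` for p = 2, 3, 4, k-independent) — and modifies no existing declaration.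
v1.2 (same unit and generation) APPENDS §6 `one_sub_half_le_of_sq`, **`window_reads_ge_tangent`** (`Σ_{j<k} h_{p+k+1+j} ≥ h_{p+k}·(k −
E′_p·k(k+1)∕4)`, `E′_p = (h_{p+k}∕h_{p+k+1})² − 1`: the tangent bound of §2 linearised, `(1+t)^{−1∕2} ≥ 1 − t∕2`) and **`load_le_of_window_tangent`**: A SHARPER
WINDOW-MASS CAP, `2x_p·(1 − (k+1)E′_p∕4) ≤ σ′_p = 1 − (h_{p+k}∕h_p)²` (with (E82b) `step_le_of_window` `kE′_p ≤ σ′_p`: `x_p ≤ (σ′_p∕2)∕(1 − 3σ′_p∕8)`, 0.39 at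
`σ′ = 0.6` against (E82b) `load_le_of_window`'s 0.45; the numerics' extremal configurations have `x ≈ 0.36` there) — and modifies no existing declaration.
-/
noncomputable section
open Finset

namespace Summit.QuantumFields.BalabanUV.Beta.EriceRemainderEnclosureHistoryAutonomyComparisonAgeCompositionDecayBudgetWindow

open Literature.MathematicalPhysics.QuantumFieldTheory.Balaban1983to89
open Literature.MathematicalPhysics.QuantumFieldTheory.Balaban1983to89.T4BetaStationary
open Literature.MathematicalPhysics.QuantumFieldTheory.Balaban1983to89.T4BetaFlowWellPosed
open Summit.QuantumFields.BalabanUV.Beta.EriceRemainderEnclosureHistoryAutonomyOrder (strictAnti_of_memFlow)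
open Summit.QuantumFields.BalabanUV.Beta.EriceRemainderEnclosureHistoryAutonomyComparisonAffineProfile (increment_anti mul_invSq_add_le)

variable {B : (ℕ → ℝ) → ℝ} {γ b gIR : ℝ} {L : ℕ → ℝ} {K : ℕ} {h : ℕ → ℝ}

/-! ## §1 The rise across a stretch dominates the reads summed over it -/

/-- **THE RISE ACROSS ANY STRETCH OF SCALES DOMINATES THE TWO AGES' READS SUMMED OVER IT.**  Along a box solution of an isotone memory with floor dominated
by `L ≥ 0` with the ages `1 ≠ k` (both `< K`): `Σ_{q<j} (L_1h_{n+q+2} + L_kh_{n+q+k+1}) ≤ 1∕h_{n+j}² − 1∕h_n²` — each level step `1∕h_{q+1}² − 1∕h_q² =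
B(h(q+1+·)) ≥ Σ_iL_ih_{q+1+i}` keeps its two loaded reads. [folklore] -/
theorem invSq_sub_ge_window_reads (hL : ∀ k, 0 ≤ L k) (hdom : ∀ u, SeqBox γ u → ∑ k ∈ range K, L k * u k ≤ B u)
    (hh : SeqBox γ h) (hf : MemFlow B gIR h) {k : ℕ} (h1K : 1 < K) (hkK : k < K) (hk1 : k ≠ 1) (n j : ℕ) :
    ∑ q ∈ range j, (L 1 * h (n + q + 2) + L k * h (n + q + k + 1)) ≤ 1 / h (n + j) ^ 2 - 1 / h n ^ 2 := by
  have hpos : ∀ n, 0 < h n := fun n => (hh n).1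
  have hsub : ({1, k} : Finset ℕ) ⊆ range K := by
    intro i hi; rw [mem_insert, mem_singleton] at hi; rw [mem_range]; rcases hi with rfl | rfl <;> assumption
  have hstep : ∀ q, L 1 * h (n + q + 2) + L k * h (n + q + k + 1) ≤ 1 / h (n + q + 1) ^ 2 - 1 / h (n + q) ^ 2 := by
    intro q
    have e1 := hf.2 (n + q)
    have hdomB : ∑ i ∈ range K, L i * h (n + q + 1 + i) ≤ B (fun i => h (n + q + 1 + i)) := hdom _ (seqBox_shift hh (n + q + 1))
    have htwo : L 1 * h (n + q + 2) + L k * h (n + q + k + 1) ≤ ∑ i ∈ range K, L i * h (n + q + 1 + i) := by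
      have := sum_le_sum_of_subset_of_nonneg hsub (f := fun i => L i * h (n + q + 1 + i)) (fun i _ _ => mul_nonneg (hL i) (hpos _).le)
      rw [sum_pair hk1.symm, show n + q + 1 + 1 = n + q + 2 by ring, show n + q + 1 + k = n + q + k + 1 by ring] at this
      exact this
    linarith
  calc ∑ q ∈ range j, (L 1 * h (n + q + 2) + L k * h (n + q + k + 1))
      ≤ ∑ q ∈ range j, (1 / h (n + (q + 1)) ^ 2 - 1 / h (n + q) ^ 2) := sum_le_sum fun q _ => by rw [show n + (q + 1) = n + q + 1 by ring]; exact hstep q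
    _ = 1 / h (n + j) ^ 2 - 1 / h n ^ 2 := by rw [sum_range_sub (fun q => 1 / h (n + q) ^ 2)]; simp

/-- **THE CRUX RELATION FOR THE SLOTS**: multiplied by `h_n²`, `h_n²·Σ_{q<j}(L_1h_{n+q+2} + L_kh_{n+q+k+1}) ≤ (h_n∕h_{n+j})² − 1` — at `n = p+1`, `j = k` this is
`h_{p+1}²·Σ_{q∈window}(L_1h_{q+2} + L_kh_{q+k+1}) ≤ ρ_p − 1`, the rise the credit step is amplified by against the reads that make up the window mass. [folklore] -/
theorem rise_ge_window_reads (hL : ∀ k, 0 ≤ L k) (hdom : ∀ u, SeqBox γ u → ∑ k ∈ range K, L k * u k ≤ B u)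
    (hh : SeqBox γ h) (hf : MemFlow B gIR h) {k : ℕ} (h1K : 1 < K) (hkK : k < K) (hk1 : k ≠ 1) (n j : ℕ) :
    h n ^ 2 * ∑ q ∈ range j, (L 1 * h (n + q + 2) + L k * h (n + q + k + 1)) ≤ (h n / h (n + j)) ^ 2 - 1 := by
  have hpos : ∀ n, 0 < h n := fun n => (hh n).1
  have hn := hpos n; have hnj := hpos (n + j)
  have h1 := invSq_sub_ge_window_reads hL hdom hh hf h1K hkK hk1 n j
  have e : h n ^ 2 * (1 / h (n + j) ^ 2 - 1 / h n ^ 2) = (h n / h (n + j)) ^ 2 - 1 := by rw [div_pow]; field_simp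
  rw [← e]
  exact mul_le_mul_of_nonneg_left h1 (le_of_lt (pow_pos hn 2))

/-! ## §2 The levels after a pin lie below the tangent at the pin -/

/-- **THE LEVELS AFTER A PIN LIE BELOW THE TANGENT**: `1∕h_{n+j}² ≤ 1∕h_n² + j·(1∕h_{n+1}² − 1∕h_n²)` along every box solution of an isotone memory with floor
— the `j` increments after `n` are each at most the one at `n` ((E58b) `increment_anti`). [folklore] -/
theorem invSq_add_le_tangent (hmono : ∀ u v : ℕ → ℝ, SeqBox γ u → SeqBox γ v → (∀ j, u j ≤ v j) → B u ≤ B v) (hb : 0 < b)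
    (hlo : ∀ u, SeqBox γ u → b ≤ B u) (hh : SeqBox γ h) (hf : MemFlow B gIR h) (n j : ℕ) :
    1 / h (n + j) ^ 2 ≤ 1 / h n ^ 2 + (j : ℝ) * (1 / h (n + 1) ^ 2 - 1 / h n ^ 2) := by
  induction j with
  | zero => simp
  | succ j ih =>
    have e := hf.2 (n + j)
    have e0 := hf.2 n
    have hle := increment_anti hmono hb hlo hh hf (show n ≤ n + j by omega)
    rw [show n + (j + 1) = n + j + 1 by ring, e]
    push_cast
    have : B (fun i => h (n + 1 + i)) = 1 / h (n + 1) ^ 2 - 1 / h n ^ 2 := by linarith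
    rw [this] at hle
    linarith

/-- **EVERY READ INSIDE THE NEXT WINDOW IS WITHIN A FACTOR OF THE READ AT ITS TOP**: `h_n² ≤ h_{n+j}²·(1 + j·((h_n∕h_{n+1})² − 1))`, i.e.
`h_{n+j} ≥ h_n·(1 + jE_n)^{−1∕2}` with `E_n` the level step at `n` (`invSq_add_le_tangent` times `h_n²h_{n+j}²`).  At `j = 2`: `(h_n∕h_{n+2})² ≤ 1 + 2E_n`, the
young debit ratio `d_{n−1}∕d_{n+1} ≤ (1 + 2E_n)^{3∕2}` of the slot of the pin `n`. [folklore] -/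
theorem read_ge_of_tangent (hmono : ∀ u v : ℕ → ℝ, SeqBox γ u → SeqBox γ v → (∀ j, u j ≤ v j) → B u ≤ B v) (hb : 0 < b)
    (hlo : ∀ u, SeqBox γ u → b ≤ B u) (hh : SeqBox γ h) (hf : MemFlow B gIR h) (n j : ℕ) :
    h n ^ 2 ≤ h (n + j) ^ 2 * (1 + (j : ℝ) * ((h n / h (n + 1)) ^ 2 - 1)) := by
  have hpos : ∀ n, 0 < h n := fun n => (hh n).1
  have hn := hpos n; have hn1 := hpos (n + 1); have hnj := hpos (n + j)
  have h1 := invSq_add_le_tangent hmono hb hlo hh hf n j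
  have := mul_le_mul_of_nonneg_left h1 (le_of_lt (mul_pos (pow_pos hn 2) (pow_pos hnj 2)))
  have e1 : h n ^ 2 * h (n + j) ^ 2 * (1 / h (n + j) ^ 2) = h n ^ 2 := by field_simp
  have e2 : h n ^ 2 * h (n + j) ^ 2 * (1 / h n ^ 2 + (j : ℝ) * (1 / h (n + 1) ^ 2 - 1 / h n ^ 2)) =
      h (n + j) ^ 2 * (1 + (j : ℝ) * ((h n / h (n + 1)) ^ 2 - 1)) := by rw [div_pow]; field_simp
  rw [e1, e2] at this
  exact this

/-! ## §3 The boundary's old part is free -/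

/-- **THE BOUNDARY'S OLD PART COSTS NOTHING**: `L_kh_{m+k+2}³∕2 ≤ 3·((L_k∕2)·h_{m+k+1}²·h_{m+2k+1})`, i.e. `c_{m+2} ≤ 3c_{m+k+1}ρ′` — the old coefficient in
the extra window damping against the old read of the old decay step: `h_{m+k+2} ≤ h_{m+k+1}` and `h_{m+k+1} ≤ 3h_{m+2k+1}` (`a_{m+2k+1} ≤ 2a_{m+k+1} ≤ 9a_{m+k+1}`,
(E58b) `mul_invSq_add_le`; `k ≥ 1`). [folklore] -/
theorem boundary_old (hmono : ∀ u v : ℕ → ℝ, SeqBox γ u → SeqBox γ v → (∀ j, u j ≤ v j) → B u ≤ B v) (hL : ∀ k, 0 ≤ L k) (hb : 0 < b)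
    (hlo : ∀ u, SeqBox γ u → b ≤ B u) (hh : SeqBox γ h) (hf : MemFlow B gIR h) {k : ℕ} (hk1 : 1 ≤ k) (m : ℕ) :
    L k * h (m + k + 2) ^ 3 / 2 ≤ 3 * (L k / 2 * h (m + k + 1) ^ 2 * h (m + 2 * k + 1)) := by
  have hpos : ∀ n, 0 < h n := fun n => (hh n).1
  have hanti := (strictAnti_of_memFlow hb hlo hh hf).antitone
  have hgIR : 0 < gIR := by rw [← hf.1]; exact hpos 0
  have hA := hpos (m + k + 1); have hC := hpos (m + 2 * k + 1); have hA2 := hpos (m + k + 2)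
  -- concavity: (m+k+1)·a_{m+2k+1} ≤ (m+2k+1)·a_{m+k+1} ≤ 2(m+k+1)·a_{m+k+1}
  have hconc := mul_invSq_add_le hmono hb hlo hgIR hh hf (m + k + 1) k
  rw [show m + k + 1 + k = m + 2 * k + 1 by ring] at hconc
  have hj : (1:ℝ) ≤ ((m + k + 1 : ℕ) : ℝ) := by exact_mod_cast (by omega : 1 ≤ m + k + 1)
  have hk : ((k : ℕ) : ℝ) ≤ ((m + k + 1 : ℕ) : ℝ) := by exact_mod_cast (by omega : k ≤ m + k + 1)
  have h9 : h (m + k + 1) ^ 2 ≤ 9 * h (m + 2 * k + 1) ^ 2 := by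
    have h2 : ((m + k + 1 : ℕ) : ℝ) * (1 / h (m + 2 * k + 1) ^ 2) ≤ 2 * ((m + k + 1 : ℕ) : ℝ) * (1 / h (m + k + 1) ^ 2) := by
      have : (((m + k + 1 : ℕ) : ℝ) + k) * (1 / h (m + k + 1) ^ 2) ≤ 2 * ((m + k + 1 : ℕ) : ℝ) * (1 / h (m + k + 1) ^ 2) :=
        mul_le_mul_of_nonneg_right (by linarith) (by positivity)
      exact hconc.trans this
    have h3 : 1 / h (m + 2 * k + 1) ^ 2 ≤ 2 * (1 / h (m + k + 1) ^ 2) := by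
      have := mul_le_mul_of_nonneg_left h2 (show (0:ℝ) ≤ 1 / ((m + k + 1 : ℕ) : ℝ) by positivity)
      rwa [← mul_assoc, one_div_mul_cancel (by positivity), one_mul, show 1 / ((m + k + 1 : ℕ) : ℝ) * (2 * ((m + k + 1 : ℕ) : ℝ) *
        (1 / h (m + k + 1) ^ 2)) = 2 * (1 / h (m + k + 1) ^ 2) by field_simp] at this
    rw [div_le_iff₀ (pow_pos hC 2)] at h3
    rw [show 2 * (1 / h (m + k + 1) ^ 2) * h (m + 2 * k + 1) ^ 2 = 2 * h (m + 2 * k + 1) ^ 2 / h (m + k + 1) ^ 2 by ring,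
      le_div_iff₀ (pow_pos hA 2), one_mul] at h3
    nlinarith [pow_pos hC 2]
  have h3' : h (m + k + 1) ≤ 3 * h (m + 2 * k + 1) := by
    have : h (m + k + 1) ^ 2 ≤ (3 * h (m + 2 * k + 1)) ^ 2 := by nlinarith
    exact (pow_le_pow_iff_left₀ hA.le (by positivity) two_ne_zero).mp this
  have hmon : h (m + k + 2) ≤ h (m + k + 1) := hanti (by omega)
  have hLk := hL k
  -- h_{m+k+2}³ ≤ h_{m+k+1}³ ≤ 3 h_{m+k+1}² h_{m+2k+1}
  have e1 : h (m + k + 2) ^ 3 ≤ h (m + k + 1) ^ 3 := pow_le_pow_left₀ hA2.le hmon 3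
  have e2 : h (m + k + 1) ^ 3 ≤ 3 * (h (m + k + 1) ^ 2 * h (m + 2 * k + 1)) := by nlinarith [pow_pos hA 2]
  nlinarith

/-! ## §4 The telescoping minorant that funds the boundary uniformly in the age -/

/-- `(c+1)^{−3∕2}`-type terms telescope: `2·(1∕√c − 1∕√(c+1)) ≤ c^{−3∕2}` for `c > 0`, written with square roots:
`2(√(c+1) − √c)·c·√c ≤ √c·√(c+1)`... stated as `2 * (1 / √c − 1 / √(c+1)) ≤ 1 / (c * √c)`. [folklore] -/
theorem rpow_neg_three_halves_ge {c : ℝ} (hc : 0 < c) : 2 * (1 / Real.sqrt c - 1 / Real.sqrt (c + 1)) ≤ 1 / (c * Real.sqrt c) := by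
  have hs : 0 < Real.sqrt c := Real.sqrt_pos.mpr hc
  have hs1 : 0 < Real.sqrt (c + 1) := Real.sqrt_pos.mpr (by linarith)
  have hsq : Real.sqrt c ^ 2 = c := Real.sq_sqrt hc.le
  have hsq1 : Real.sqrt (c + 1) ^ 2 = c + 1 := Real.sq_sqrt (by linarith)
  have hle : Real.sqrt c ≤ Real.sqrt (c + 1) := Real.sqrt_le_sqrt (by linarith)
  -- 2(√(c+1) − √c)·c ≤ √(c+1):  (√(c+1) − √c) = 1/(√(c+1)+√c) ≤ 1/(2√c)
  rw [div_sub_div _ _ hs.ne' hs1.ne', mul_div_assoc', div_le_div_iff₀ (mul_pos hs hs1) (mul_pos hc hs)]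
  have hdiff : (Real.sqrt (c + 1) - Real.sqrt c) * (Real.sqrt (c + 1) + Real.sqrt c) = 1 := by nlinarith
  have hdiff' : Real.sqrt (c + 1) - Real.sqrt c ≤ 1 / (2 * Real.sqrt c) := by
    rw [le_div_iff₀ (by positivity)]; nlinarith
  have hd0 : 0 ≤ Real.sqrt (c + 1) - Real.sqrt c := by linarith
  calc 2 * (1 * Real.sqrt (c + 1) - Real.sqrt c * 1) * (c * Real.sqrt c)
      = 2 * (Real.sqrt (c + 1) - Real.sqrt c) * (c * Real.sqrt c) := by ring
    _ ≤ 2 * (1 / (2 * Real.sqrt c)) * (c * Real.sqrt c) := by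
        exact mul_le_mul_of_nonneg_right (mul_le_mul_of_nonneg_left hdiff' (by norm_num)) (by positivity)
    _ = c := by field_simp
    _ = 1 * (Real.sqrt c * Real.sqrt c) := by rw [← sq, hsq, one_mul]
    _ ≤ 1 * (Real.sqrt c * Real.sqrt (c + 1)) := by
        exact mul_le_mul_of_nonneg_left (mul_le_mul_of_nonneg_left hle hs.le) zero_le_one

/-- **THE TELESCOPING MINORANT**: `Σ_{j<k} 1∕((c+j)·√(c+j)) ≥ 2·(1∕√c − 1∕√(c+k))` for `c > 0` — the k-uniform lower bound for the boundary's funding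
`Σ_p S_p ∝ Σ_p d_{p+1} ≥ d_{m+2}·Σ_j ((m+3)∕(m+4+j))^{3∕2}` ((E58b) `mul_sqrt_le_read`). [folklore] -/
theorem sum_rpow_ge_telescope {c : ℝ} (hc : 0 < c) (k : ℕ) :
    2 * (1 / Real.sqrt c - 1 / Real.sqrt (c + k)) ≤ ∑ j ∈ range k, 1 / ((c + j) * Real.sqrt (c + j)) := by
  induction k with
  | zero => simp
  | succ k ih =>
    rw [sum_range_succ]
    have hck : 0 < c + k := by positivity
    have h1 := rpow_neg_three_halves_ge hck
    push_cast
    rw [show c + ((k : ℝ) + 1) = c + k + 1 by ring]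
    linarith

/-! ## §5 (v1.1) The young window-damping debit against the young credit, with no window-mass factor -/

/-- **THE YOUNG DEBIT OF A SLOT IS AT MOST `(1+1∕p)²` TIMES ITS YOUNG CREDIT UNIT**: along a box solution of an isotone memory with floor, for `p ≥ 1`,
`h_p³ ≤ (1 + 1∕p)²·h_{p+1}²·h_{p+2}` — `(h_p∕h_{p+1})² ≤ 1 + 1∕p` ((E84c) `step_le_inv`), `(h_p∕h_{p+2})² ≤ 1 + 2((h_p∕h_{p+1})² − 1) ≤ 1 + 2∕p` (§2
`read_ge_of_tangent` at `j = 2`) and `1 + 2∕p ≤ (1 + 1∕p)²`.  Times `L_1∕2`: `d_{p−1} ≤ (1+1∕p)²·d_{p+1}ρ¹_p`, against the young credit `3d_{p+1}ρ¹_p` of the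
slot. [folklore] -/
theorem young_debit_le (hmono : ∀ u v : ℕ → ℝ, SeqBox γ u → SeqBox γ v → (∀ j, u j ≤ v j) → B u ≤ B v) (hb : 0 < b)
    (hlo : ∀ u, SeqBox γ u → b ≤ B u) (hh : SeqBox γ h) (hf : MemFlow B gIR h) {p : ℕ} (hp : 1 ≤ p) :
    h p ^ 3 ≤ (1 + 1 / (p : ℝ)) ^ 2 * (h (p + 1) ^ 2 * h (p + 2)) := by
  have hpos : ∀ n, 0 < h n := fun n => (hh n).1
  have h0 := hpos p; have h1 := hpos (p + 1); have h2 := hpos (p + 2)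
  have hpr : (1 : ℝ) ≤ p := by exact_mod_cast hp
  -- the step at p: (h_p/h_{p+1})^2 ≤ 1 + 1/p
  have hstep := Summit.QuantumFields.BalabanUV.Beta.EriceRemainderEnclosureHistoryAutonomyComparisonAgeCompositionDecayBudgetSlots.step_le_inv
    hmono hb hlo hh hf p
  have hr : (h p / h (p + 1)) ^ 2 ≤ 1 + 1 / (p : ℝ) := by
    -- 1 - (h_{p+1}/h_p)^2 ≤ 1/(p+1)  ⟹  (h_p/h_{p+1})^2 ≤ 1/(1 - 1/(p+1)) = 1 + 1/p
    have e1 : (h (p + 1) / h p) ^ 2 ≥ 1 - 1 / ((p : ℝ) + 1) := by linarith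
    have e2 : 1 - 1 / ((p : ℝ) + 1) = (p : ℝ) / ((p : ℝ) + 1) := by field_simp; ring
    rw [e2, div_pow, ge_iff_le, div_le_div_iff₀ (by positivity) (pow_pos h0 2)] at e1
    rw [div_pow, div_le_iff₀ (pow_pos h1 2), show (1 + 1 / (p : ℝ)) * h (p + 1) ^ 2 = ((p : ℝ) + 1) * h (p + 1) ^ 2 / p by field_simp,
      le_div_iff₀ (by positivity)]
    linarith
  -- two steps: (h_p/h_{p+2})^2 ≤ 1 + 2((h_p/h_{p+1})^2 - 1) ≤ 1 + 2/p ≤ (1 + 1/p)^2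
  have htan := read_ge_of_tangent hmono hb hlo hh hf p 2
  push_cast at htan
  have hq : h p ^ 2 ≤ h (p + 2) ^ 2 * (1 + 1 / (p : ℝ)) ^ 2 := by
    have : 1 + 2 * ((h p / h (p + 1)) ^ 2 - 1) ≤ (1 + 1 / (p : ℝ)) ^ 2 := by nlinarith [sq_nonneg (1 / (p : ℝ))]
    exact htan.trans (mul_le_mul_of_nonneg_left this (le_of_lt (pow_pos h2 2)))
  -- h_p ≤ (1+1/p) h_{p+2} and h_p^2 ≤ (1+1/p) h_{p+1}^2
  have ha : h p ≤ (1 + 1 / (p : ℝ)) * h (p + 2) := by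
    have : h p ^ 2 ≤ ((1 + 1 / (p : ℝ)) * h (p + 2)) ^ 2 := by nlinarith
    exact (pow_le_pow_iff_left₀ h0.le (by positivity) two_ne_zero).mp this
  have hb' : h p ^ 2 ≤ (1 + 1 / (p : ℝ)) * h (p + 1) ^ 2 := by
    rw [div_pow, div_le_iff₀ (pow_pos h1 2)] at hr; linarith
  calc h p ^ 3 = h p ^ 2 * h p := by ring
    _ ≤ ((1 + 1 / (p : ℝ)) * h (p + 1) ^ 2) * ((1 + 1 / (p : ℝ)) * h (p + 2)) := mul_le_mul hb' ha h0.le (by positivity)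
    _ = (1 + 1 / (p : ℝ)) ^ 2 * (h (p + 1) ^ 2 * h (p + 2)) := by ring

/-! ## §6 (v1.2) A sharper window-mass cap from the tangent bound -/

/-- `1 − t∕2 ≤ r` when `0 ≤ r`, `0 ≤ t` and `1 ≤ r²(1+t)` (`(1+t)^{−1∕2} ≥ 1 − t∕2`). [folklore] -/
theorem one_sub_half_le_of_sq {r t : ℝ} (hr : 0 ≤ r) (ht : 0 ≤ t) (h1 : 1 ≤ r ^ 2 * (1 + t)) : 1 - t / 2 ≤ r := by
  rcases le_or_gt (1 - t / 2) 0 with hc | hc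
  · linarith
  · -- (1 − t/2)²(1+t) = 1 − (3/4)t² + t³/4 ≤ 1 for t ≤ 2
    have ht2 : t < 2 := by linarith
    have hkey : (1 - t / 2) ^ 2 * (1 + t) ≤ 1 := by nlinarith [sq_nonneg t, mul_nonneg (sq_nonneg t) ht]
    have h2 : (1 - t / 2) ^ 2 * (1 + t) ≤ r ^ 2 * (1 + t) := hkey.trans h1
    have h3 : (1 - t / 2) ^ 2 ≤ r ^ 2 := le_of_mul_le_mul_right h2 (by linarith)
    nlinarith [sq_nonneg (r - (1 - t / 2)), sq_nonneg (r + (1 - t / 2))]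

/-- **THE READS OF THE NEXT WINDOW ARE AT LEAST `k − E′k(k+1)∕4` TIMES THE READ AT ITS TOP**: along a box solution of an isotone memory with floor,
`Σ_{j<k} h_{p+k+1+j} ≥ h_{p+k}·(k − ((h_{p+k}∕h_{p+k+1})² − 1)·k(k+1)∕4)` — §2 `read_ge_of_tangent` at the pin `p+k` and `(1+t)^{−1∕2} ≥ 1 − t∕2`. [folklore] -/
theorem window_reads_ge_tangent (hmono : ∀ u v : ℕ → ℝ, SeqBox γ u → SeqBox γ v → (∀ j, u j ≤ v j) → B u ≤ B v) (hb : 0 < b)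
    (hlo : ∀ u, SeqBox γ u → b ≤ B u) (hh : SeqBox γ h) (hf : MemFlow B gIR h) (p k : ℕ) :
    h (p + k) * ((k : ℝ) - ((h (p + k) / h (p + k + 1)) ^ 2 - 1) * ((k : ℝ) * ((k : ℝ) + 1) / 4)) ≤ ∑ j ∈ range k, h (p + k + 1 + j) := by
  have hpos : ∀ n, 0 < h n := fun n => (hh n).1
  have hanti := (strictAnti_of_memFlow hb hlo hh hf).antitone
  have hpk := hpos (p + k); have hpk1 := hpos (p + k + 1)
  set E := (h (p + k) / h (p + k + 1)) ^ 2 - 1 with hE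
  have hE0 : 0 ≤ E := by
    have : 1 ≤ h (p + k) / h (p + k + 1) := by rw [le_div_iff₀ hpk1, one_mul]; exact hanti (by omega)
    rw [hE]; nlinarith
  have hterm : ∀ j ∈ range k, h (p + k) * (1 - (((j : ℝ) + 1) * E) / 2) ≤ h (p + k + 1 + j) := by
    intro j _
    have ht := read_ge_of_tangent hmono hb hlo hh hf (p + k) (j + 1)
    rw [show p + k + (j + 1) = p + k + 1 + j by ring] at ht
    push_cast at ht
    have hr0 : 0 ≤ h (p + k + 1 + j) / h (p + k) := div_nonneg (hpos _).le hpk.le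
    have h1 : 1 ≤ (h (p + k + 1 + j) / h (p + k)) ^ 2 * (1 + ((j : ℝ) + 1) * E) := by
      rw [div_pow, div_mul_eq_mul_div, le_div_iff₀ (pow_pos hpk 2), one_mul, hE]; exact ht
    have := one_sub_half_le_of_sq hr0 (by positivity) h1
    rw [le_div_iff₀ hpk] at this
    linarith
  -- Gauss: Σ_{j<k} (j+1) = k(k+1)/2 (as the ABC tree's `sum_range_natCast_succ`, inlined)
  have hgauss : ∀ n : ℕ, ∑ j ∈ range n, ((j : ℝ) + 1) = (n : ℝ) * ((n : ℝ) + 1) / 2 := by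
    intro n
    induction n with
    | zero => simp
    | succ n ih => rw [sum_range_succ, ih]; push_cast; ring
  calc h (p + k) * ((k : ℝ) - E * ((k : ℝ) * ((k : ℝ) + 1) / 4))
      = ∑ j ∈ range k, h (p + k) * (1 - (((j : ℝ) + 1) * E) / 2) := by
        rw [← mul_sum, sum_sub_distrib, sum_const, card_range, nsmul_eq_mul, mul_one, ← sum_div, ← sum_mul, hgauss]; ring
    _ ≤ ∑ j ∈ range k, h (p + k + 1 + j) := sum_le_sum hterm

/-- **A SHARPER WINDOW-MASS CAP**: along a box solution of an isotone memory with floor dominated by `L ≥ 0` with the ages `1 ≠ k` (both `< K`), at every pin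
`p`, with `x_p = k·L_kh_{p+k}³∕2`, `E′_p = (h_{p+k}∕h_{p+k+1})² − 1` and `σ′_p = 1 − (h_{p+k}∕h_p)²`:  `2x_p·(1 − (k+1)E′_p∕4) ≤ σ′_p` — the rise across the window
dominates the old reads summed over it (§1), which are at least `k − E′k(k+1)∕4` reads at the window's bottom (`window_reads_ge_tangent`).  With (E82b)
`step_le_of_window` (`kE′_p ≤ σ′_p`): `x_p ≤ (σ′_p∕2)∕(1 − (σ′_p + E′_p)∕4) ≤ (σ′_p∕2)∕(1 − 3σ′_p∕8)` for `k ≥ 2`. [folklore] -/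
theorem load_le_of_window_tangent (hmono : ∀ u v : ℕ → ℝ, SeqBox γ u → SeqBox γ v → (∀ j, u j ≤ v j) → B u ≤ B v) (hL : ∀ k, 0 ≤ L k)
    (hb : 0 < b) (hlo : ∀ u, SeqBox γ u → b ≤ B u) (hdom : ∀ u, SeqBox γ u → ∑ k ∈ range K, L k * u k ≤ B u)
    (hh : SeqBox γ h) (hf : MemFlow B gIR h) {k : ℕ} (h1K : 1 < K) (hkK : k < K) (hk1 : k ≠ 1) (p : ℕ) :
    2 * ((k : ℝ) * (L k * h (p + k) ^ 3 / 2)) * (1 - ((k : ℝ) + 1) * ((h (p + k) / h (p + k + 1)) ^ 2 - 1) / 4) ≤ 1 - (h (p + k) / h p) ^ 2 := by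
  have hpos : ∀ n, 0 < h n := fun n => (hh n).1
  have hp0 := hpos p; have hpk := hpos (p + k)
  -- the rise dominates the old reads summed over the window
  have hrise := invSq_sub_ge_window_reads hL hdom hh hf h1K hkK hk1 p k
  have hold : L k * ∑ j ∈ range k, h (p + k + 1 + j) ≤ 1 / h (p + k) ^ 2 - 1 / h p ^ 2 := by
    refine le_trans ?_ hrise
    rw [mul_sum]
    exact sum_le_sum fun q _ => by
      rw [show p + k + 1 + q = p + q + k + 1 by ring]
      have := mul_nonneg (hL 1) (hpos (p + q + 2)).le
      linarith
  -- the reads at the window's bottom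
  have hreads := window_reads_ge_tangent hmono hb hlo hh hf p k
  have hLk := hL k
  have h1 : L k * (h (p + k) * ((k : ℝ) - ((h (p + k) / h (p + k + 1)) ^ 2 - 1) * ((k : ℝ) * ((k : ℝ) + 1) / 4))) ≤
      1 / h (p + k) ^ 2 - 1 / h p ^ 2 := (mul_le_mul_of_nonneg_left hreads hLk).trans hold
  -- multiply by h_{p+k}²
  have h2 := mul_le_mul_of_nonneg_left h1 (le_of_lt (pow_pos hpk 2))
  have e1 : h (p + k) ^ 2 * (1 / h (p + k) ^ 2 - 1 / h p ^ 2) = 1 - (h (p + k) / h p) ^ 2 := by rw [div_pow]; field_simp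
  have e2 : h (p + k) ^ 2 * (L k * (h (p + k) * ((k : ℝ) - ((h (p + k) / h (p + k + 1)) ^ 2 - 1) * ((k : ℝ) * ((k : ℝ) + 1) / 4)))) =
      2 * ((k : ℝ) * (L k * h (p + k) ^ 3 / 2)) * (1 - ((k : ℝ) + 1) * ((h (p + k) / h (p + k + 1)) ^ 2 - 1) / 4) := by ring
  rw [e1, e2] at h2
  exact h2

end Summit.QuantumFields.BalabanUV.Beta.EriceRemainderEnclosureHistoryAutonomyComparisonAgeCompositionDecayBudgetWindow

end
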